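import Literature.Computability.MetaComplexity.TruthTableTautology
import Literature.Computability.Complexity.CircuitSemantics
import Mathlib.Data.Nat.Pairing
import HarnessLib

/-!
# Correctness of Razborov's CNF `Circuit_{s,n}(f, q)` — the named fact `circuitCNF_satisfiable_iff` PROVED

Discharge of the named fact `Literature.Computability.MetaComplexity.circuitCNF_satisfiable_iff` of
`Literature/Computability/MetaComplexity/TruthTableTautology.lean` (Razborov 1996, §5, p. 62: the CNF
`Circuit_{t,n}(f_n, q)` saying «the description `q` is a `B₂`-circuit with `t` gates whose evaluation on all `2ⁿ`
rows agrees with `f_n`»; Krajíček 2019, §19.5, p. 425), as `circuitCNF_satisfiable_iff_holds`: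

for `0 < n`, `TT.circuitCNF s n f` is satisfiable iff some circuit over `B2` with at most `s` gates computes `f`.

This is the routine correctness of the encoding which the source uses without comment and which the def's
docstring describes («forward: read the gates off the selector/op-table bits, values certified row by row by the
wiring/gate/output clauses; backward: binary op-tables simulate fan-in `≤ 2`, pad with dummy gates to exactly
`s`»). We follow exactly that description, on the tree's gate-by-gate semantics of circuits
(`Literature.Computability.Complexity.CircuitSemantics`: `transcript`, the gate equations
`getD_transcript_eq_gateValue`, `eval_eq_wireVal`, the binary truth table `btable`, and `Circuit.padTo`):

* `TT.exists_circuit_of_satisfiable` (the `→` half, for every `n`; this is the half behind the route direction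
  `ttForm_isTautology_of_lt_circuitSizeOver`): from a satisfying assignment `σ` choose, for every gate `j < s` and
  argument `k < 2`, a source `w < n + j` whose selector bit is true, and an output source; the circuit has the
  `s` BINARY gates `v ↦ σ(opV j (v 0) (v 1))` wired to the chosen sources; by strong induction on `j`, on every row
  `x` the true transcript of this circuit is `j ↦ σ(gateV x j)` (input clauses, wiring clauses, gate clauses),
  whence its output is `σ(resV x) = f(x)` (output and target clauses).
* `TT.satisfiable_of_circuit` (the `←` half, needs `0 < n`): pad the circuit to exactly `s` gates
  (`Circuit.padTo`, same function, still over `B2`); the assignment gives gate `j` the op-table `btable` of the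
  `j`-th gate, wires argument `k` to the gate's `k`-th wire (to the dummy source `0`, an input, when `k` exceeds
  the arity — here `0 < n` is used), the output to the output wire, and the value variables of row `x` to the true
  transcript on the `x`-th input; all six clause families are then checked.

Everything here is a `theorem` (no definition, no new named fact); the named fact stays a `def` in its file and
its users are fed `circuitCNF_satisfiable_iff_holds`.

## References

* [Razborov1996ICALP] A. A. Razborov, *Lower bounds for propositional proofs and independence results in bounded
  arithmetic*, ICALP 1996, LNCS 1099, 48–62, §5 p. 62 (`Circuit_{t,n}(f_n, q)`).
* [KrajicekProofComplexity2019] J. Krajíček, *Proof complexity*, CUP 2019, §19.5 pp. 425–427.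
-/

namespace Literature.Computability.MetaComplexity

open Literature.Computability.Complexity

namespace TT

/-! ## Clause semantics (tools) -/

/-- A clause is true under `σ` iff one of its literals is. [folklore] -/
private theorem ceval_iff (σ : ℕ → Bool) (c : Clause ℕ) :
    Clause.eval σ c = true ↔ ∃ l ∈ c, σ l.1 = l.2 := by
  simp [Clause.eval, List.any_eq_true, Literal.eval]

/-- A clause containing a true literal is true. [folklore] -/
private theorem ceval_of_mem {σ : ℕ → Bool} {c : Clause ℕ} (u : ℕ) (b : Bool) (hm : (u, b) ∈ c)
    (h : σ u = b) : Clause.eval σ c = true :=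
  (ceval_iff σ c).2 ⟨(u, b), hm, h⟩

/-- Reading a true unit clause. [folklore] -/
private theorem of_ceval1 {σ : ℕ → Bool} {u : ℕ} {b : Bool} (h : Clause.eval σ [(u, b)] = true) : σ u = b := by
  obtain ⟨l, hl, hσ⟩ := (ceval_iff σ _).1 h
  simp only [List.mem_cons, List.not_mem_nil, or_false] at hl
  subst hl; exact hσ

/-- Reading a true clause of three literals. [folklore] -/
private theorem of_ceval3 {σ : ℕ → Bool} {u₁ u₂ u₃ : ℕ} {b₁ b₂ b₃ : Bool}
    (h : Clause.eval σ [(u₁, b₁), (u₂, b₂), (u₃, b₃)] = true) : σ u₁ = b₁ ∨ σ u₂ = b₂ ∨ σ u₃ = b₃ := by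
  obtain ⟨l, hl, hσ⟩ := (ceval_iff σ _).1 h
  simp only [List.mem_cons, List.not_mem_nil, or_false] at hl
  rcases hl with rfl | rfl | rfl
  · exact Or.inl hσ
  · exact Or.inr (Or.inl hσ)
  · exact Or.inr (Or.inr hσ)

/-- Reading a true clause of four literals. [folklore] -/
private theorem of_ceval4 {σ : ℕ → Bool} {u₁ u₂ u₃ u₄ : ℕ} {b₁ b₂ b₃ b₄ : Bool}
    (h : Clause.eval σ [(u₁, b₁), (u₂, b₂), (u₃, b₃), (u₄, b₄)] = true) :
    σ u₁ = b₁ ∨ σ u₂ = b₂ ∨ σ u₃ = b₃ ∨ σ u₄ = b₄ := by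
  obtain ⟨l, hl, hσ⟩ := (ceval_iff σ _).1 h
  simp only [List.mem_cons, List.not_mem_nil, or_false] at hl
  rcases hl with rfl | rfl | rfl | rfl
  · exact Or.inl hσ
  · exact Or.inr (Or.inl hσ)
  · exact Or.inr (Or.inr (Or.inl hσ))
  · exact Or.inr (Or.inr (Or.inr hσ))

/-- Reading a true selector clause: some listed source has a true selector bit. [folklore] -/
private theorem of_ceval_map {σ : ℕ → Bool} {l : List ℕ} {g : ℕ → ℕ}
    (h : Clause.eval σ (l.map fun w => (g w, true)) = true) : ∃ w ∈ l, σ (g w) = true := by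
  obtain ⟨lit, hl, hσ⟩ := (ceval_iff σ _).1 h
  rw [List.mem_map] at hl
  obtain ⟨w, hw, rfl⟩ := hl
  exact ⟨w, hw, hσ⟩

/-- Two Booleans that differ are complementary. [folklore] -/
private theorem eq_not_of_ne' {a b : Bool} (h : a ≠ b) : a = !b := by
  cases a <;> cases b <;> simp_all

/-! ## Membership in the six clause families -/

/-- The clauses of `selClauses s n`. [cite: Razborov1996ICALP, §5 p. 62] -/
private theorem mem_selClauses {s n : ℕ} {c : Clause ℕ} :
    c ∈ selClauses s n ↔
      (∃ j < s, ∃ k < 2, c = (List.range (n + j)).map fun w => (selV j k w, true)) ∨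
        c = (List.range (n + s)).map fun w => (outV w, true) := by
  unfold selClauses
  simp only [List.mem_append, List.mem_flatMap, List.mem_range, List.mem_map, List.mem_cons,
    List.not_mem_nil, or_false]
  constructor
  · rintro (⟨j, hj, k, hk, h⟩ | h)
    · exact Or.inl ⟨j, hj, k, hk, h.symm⟩
    · exact Or.inr h
  · rintro (⟨j, hj, k, hk, h⟩ | h)
    · exact Or.inl ⟨j, hj, k, hk, h.symm⟩
    · exact Or.inr h

/-- The clauses of `inputClauses n`. [cite: Razborov1996ICALP, §5 p. 62] -/
private theorem mem_inputClauses {n : ℕ} {c : Clause ℕ} :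
    c ∈ inputClauses n ↔ ∃ (x : Fin (2 ^ n)) (i : Fin n), c = [(inV x.1 i.1, (boolFunEquivFin n).symm x i)] := by
  unfold inputClauses
  simp only [List.mem_flatMap, List.mem_finRange, true_and, List.mem_map]
  constructor
  · rintro ⟨x, i, h⟩; exact ⟨x, i, h.symm⟩
  · rintro ⟨x, i, h⟩; exact ⟨x, i, h.symm⟩

/-- The clauses of `argClauses s n`. [cite: Razborov1996ICALP, §5 p. 62] -/
private theorem mem_argClauses {s n : ℕ} {c : Clause ℕ} :
    c ∈ argClauses s n ↔ ∃ x < 2 ^ n, ∃ j < s, ∃ k < 2, ∃ w < n + j,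
      c = [(selV j k w, false), (argV x j k, false), (srcV n x w, true)] ∨
        c = [(selV j k w, false), (argV x j k, true), (srcV n x w, false)] := by
  unfold argClauses
  simp only [List.mem_flatMap, List.mem_range, List.mem_cons, List.not_mem_nil, or_false]

/-- The clauses of `gateClauses s n`. [cite: Razborov1996ICALP, §5 p. 62] -/
private theorem mem_gateClauses {s n : ℕ} {c : Clause ℕ} :
    c ∈ gateClauses s n ↔ ∃ x < 2 ^ n, ∃ j < s, ∃ a b : Bool,
      c = [(argV x j 0, !a), (argV x j 1, !b), (gateV x j, false), (opV j a b, true)] ∨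
        c = [(argV x j 0, !a), (argV x j 1, !b), (gateV x j, true), (opV j a b, false)] := by
  unfold gateClauses
  simp only [List.mem_flatMap, List.mem_range, List.mem_cons, List.not_mem_nil, or_false]
  constructor
  · rintro ⟨x, hx, j, hj, a, -, b, -, h⟩
    exact ⟨x, hx, j, hj, a, b, h⟩
  · rintro ⟨x, hx, j, hj, a, b, h⟩
    refine ⟨x, hx, j, hj, a, ?_, b, ?_, h⟩
    · cases a
      · exact Or.inl rfl
      · exact Or.inr rfl
    · cases b
      · exact Or.inl rfl
      · exact Or.inr rfl

/-- The clauses of `outClauses s n`. [cite: Razborov1996ICALP, §5 p. 62] -/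
private theorem mem_outClauses {s n : ℕ} {c : Clause ℕ} :
    c ∈ outClauses s n ↔ ∃ x < 2 ^ n, ∃ w < n + s,
      c = [(outV w, false), (resV x, false), (srcV n x w, true)] ∨
        c = [(outV w, false), (resV x, true), (srcV n x w, false)] := by
  unfold outClauses
  simp only [List.mem_flatMap, List.mem_range, List.mem_cons, List.not_mem_nil, or_false]

/-- The clauses of `targetClauses n f`. [cite: Razborov1996ICALP, §5 p. 62] -/
private theorem mem_targetClauses {n : ℕ} {f : (Fin n → Bool) → Bool} {c : Clause ℕ} :
    c ∈ targetClauses n f ↔ ∃ x : Fin (2 ^ n), c = [(resV x.1, f ((boolFunEquivFin n).symm x))] := by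
  unfold targetClauses
  simp only [List.mem_map, List.mem_finRange, true_and]
  constructor
  · rintro ⟨x, h⟩; exact ⟨x, h.symm⟩
  · rintro ⟨x, h⟩; exact ⟨x, h.symm⟩

/-- The clauses of `circuitCNF s n f` are those of the six families. [cite: Razborov1996ICALP, §5 p. 62] -/
private theorem mem_circuitCNF {s n : ℕ} {f : (Fin n → Bool) → Bool} {c : Clause ℕ} :
    c ∈ circuitCNF s n f ↔ c ∈ selClauses s n ∨ c ∈ inputClauses n ∨ c ∈ argClauses s n ∨
      c ∈ gateClauses s n ∨ c ∈ outClauses s n ∨ c ∈ targetClauses n f := by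
  unfold circuitCNF
  simp only [List.mem_append, or_assoc]

/-! ## The `→` half: from a satisfying assignment to a circuit -/

/-- **Soundness of the encoding**: if `Circuit_{s,n}(f, q)` is satisfiable then some circuit over `B2` with at
most `s` (in fact exactly `s`, binary) gates computes `f` — the gates are read off the true selector bits and
the op-table bits of a satisfying assignment, and on every row the true transcript of this circuit is forced,
gate by gate, to be the assignment's gate values. (No hypothesis on `n`.)
[cite: Razborov1996ICALP, §5 p. 62] [cite: KrajicekProofComplexity2019, §19.5 p. 425] -/
theorem exists_circuit_of_satisfiable {s n : ℕ} (f : (Fin n → Bool) → Bool)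
    (hsat : (circuitCNF s n f).Satisfiable) :
    ∃ C : Circuit (Fin n), C.IsOver B2 ∧ C.Computes f ∧ C.size ≤ s := by
  obtain ⟨σ, hσ⟩ := hsat
  have hall := (CNF.eval_eq_true_iff _ σ).1 hσ
  -- the six clause families, read as facts about `σ`
  have hsel : ∀ j < s, ∀ k < 2, ∃ w < n + j, σ (selV j k w) = true := by
    intro j hj k hk
    have h := hall _ (mem_circuitCNF.2 (Or.inl (mem_selClauses.2 (Or.inl ⟨j, hj, k, hk, rfl⟩))))
    obtain ⟨w, hw, hσw⟩ := of_ceval_map h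
    exact ⟨w, List.mem_range.1 hw, hσw⟩
  have hout : ∃ w < n + s, σ (outV w) = true := by
    have h := hall _ (mem_circuitCNF.2 (Or.inl (mem_selClauses.2 (Or.inr rfl))))
    obtain ⟨w, hw, hσw⟩ := of_ceval_map h
    exact ⟨w, List.mem_range.1 hw, hσw⟩
  have hin : ∀ (x : Fin (2 ^ n)) (i : Fin n), σ (inV x.1 i.1) = (boolFunEquivFin n).symm x i := fun x i =>
    of_ceval1 (hall _ (mem_circuitCNF.2 (Or.inr (Or.inl (mem_inputClauses.2 ⟨x, i, rfl⟩)))))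
  have harg : ∀ x < 2 ^ n, ∀ j < s, ∀ k < 2, ∀ w < n + j, σ (selV j k w) = true →
      σ (argV x j k) = σ (srcV n x w) := by
    intro x hx j hj k hk w hw hs
    have h₁ := of_ceval3 (hall _ (mem_circuitCNF.2 (Or.inr (Or.inr (Or.inl
      (mem_argClauses.2 ⟨x, hx, j, hj, k, hk, w, hw, Or.inl rfl⟩))))))
    have h₂ := of_ceval3 (hall _ (mem_circuitCNF.2 (Or.inr (Or.inr (Or.inl
      (mem_argClauses.2 ⟨x, hx, j, hj, k, hk, w, hw, Or.inr rfl⟩))))))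
    rw [hs] at h₁ h₂
    revert h₁ h₂
    cases σ (argV x j k) <;> cases σ (srcV n x w) <;> simp
  have hgate : ∀ x < 2 ^ n, ∀ j < s,
      σ (gateV x j) = σ (opV j (σ (argV x j 0)) (σ (argV x j 1))) := by
    intro x hx j hj
    have h₁ := of_ceval4 (hall _ (mem_circuitCNF.2 (Or.inr (Or.inr (Or.inr (Or.inl
      (mem_gateClauses.2 ⟨x, hx, j, hj, σ (argV x j 0), σ (argV x j 1), Or.inl rfl⟩)))))))
    have h₂ := of_ceval4 (hall _ (mem_circuitCNF.2 (Or.inr (Or.inr (Or.inr (Or.inl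
      (mem_gateClauses.2 ⟨x, hx, j, hj, σ (argV x j 0), σ (argV x j 1), Or.inr rfl⟩)))))))
    revert h₁ h₂
    cases σ (argV x j 0) <;> cases σ (argV x j 1) <;> cases σ (gateV x j) <;>
      cases σ (opV j _ _) <;> simp
  have houtc : ∀ x < 2 ^ n, ∀ w < n + s, σ (outV w) = true → σ (resV x) = σ (srcV n x w) := by
    intro x hx w hw hs
    have h₁ := of_ceval3 (hall _ (mem_circuitCNF.2 (Or.inr (Or.inr (Or.inr (Or.inr (Or.inl
      (mem_outClauses.2 ⟨x, hx, w, hw, Or.inl rfl⟩))))))))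
    have h₂ := of_ceval3 (hall _ (mem_circuitCNF.2 (Or.inr (Or.inr (Or.inr (Or.inr (Or.inl
      (mem_outClauses.2 ⟨x, hx, w, hw, Or.inr rfl⟩))))))))
    rw [hs] at h₁ h₂
    revert h₁ h₂
    cases σ (resV x) <;> cases σ (srcV n x w) <;> simp
  have htgt : ∀ x : Fin (2 ^ n), σ (resV x.1) = f ((boolFunEquivFin n).symm x) := fun x =>
    of_ceval1 (hall _ (mem_circuitCNF.2 (Or.inr (Or.inr (Or.inr (Or.inr (Or.inr
      (mem_targetClauses.2 ⟨x, rfl⟩))))))))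
  -- choice of one true source per argument, and of the output source
  have hsel' : ∀ j k : ℕ, ∃ w : ℕ, j < s → k < 2 → (w < n + j ∧ σ (selV j k w) = true) := by
    intro j k
    by_cases hj : j < s
    · by_cases hk : k < 2
      · obtain ⟨w, hw, hσw⟩ := hsel j hj k hk
        exact ⟨w, fun _ _ => ⟨hw, hσw⟩⟩
      · exact ⟨0, fun _ h => absurd h hk⟩
    · exact ⟨0, fun h => absurd h hj⟩
  choose src hsrc using hsel'
  obtain ⟨out, hout_lt, hσout⟩ := hout
  -- wires: source `w` is input `w` if `w < n`, else gate `w - n`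
  obtain ⟨tw, htw⟩ : ∃ tw : ℕ → Fin n ⊕ ℕ,
      ∀ w, tw w = if h : w < n then Sum.inl ⟨w, h⟩ else Sum.inr (w - n) := ⟨_, fun _ => rfl⟩
  have htw_lt : ∀ {w : ℕ} (h : w < n), tw w = Sum.inl ⟨w, h⟩ := fun h => by rw [htw, dif_pos h]
  have htw_ge : ∀ {w : ℕ}, ¬ w < n → tw w = Sum.inr (w - n) := fun h => by rw [htw, dif_neg h]
  -- the gates: binary, op-table read off `σ`, wired to the chosen sources
  obtain ⟨G, hG⟩ : ∃ G : Fin s → Gate (Fin n),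
      ∀ j, G j = ⟨2, fun u => σ (opV j (u 0) (u 1)), fun k => tw (src j k)⟩ := ⟨_, fun _ => rfl⟩
  obtain ⟨gates, hgates⟩ : ∃ gates : List (Gate (Fin n)), gates = List.ofFn G := ⟨_, rfl⟩
  have hlen : gates.length = s := by rw [hgates, List.length_ofFn]
  have hget : ∀ (j : ℕ) (hj : j < s) (hj' : j < gates.length),
      gates[j] = ⟨2, fun u => σ (opV j (u 0) (u 1)), fun k => tw (src j k)⟩ := by
    intro j hj hj'
    subst hgates
    rw [List.getElem_ofFn, hG]
  have hwf : ∀ (j : ℕ) (h : j < gates.length) (a : Fin (gates[j]).arity) (m : ℕ),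
      (gates[j]).args a = .inr m → m < j := by
    intro j hj a m ha
    have hjs : j < s := hlen ▸ hj
    have hg := hget j hjs hj
    generalize gates[j] = g at hg a ha
    subst hg
    change tw (src j a) = Sum.inr m at ha
    have h2 := hsrc j a hjs a.isLt
    by_cases hlt : src j a < n
    · rw [htw_lt hlt] at ha; cases ha
    · rw [htw_ge hlt] at ha
      cases ha
      omega
  have hwfo : ∀ m, tw out = .inr m → m < gates.length := by
    intro m hm
    by_cases hlt : out < n
    · rw [htw_lt hlt] at hm; cases hm
    · rw [htw_ge hlt] at hm
      cases hm
      omega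
  let C : Circuit (Fin n) := ⟨gates, tw out, hwf, hwfo⟩
  refine ⟨C, ?_, ?_, le_of_eq hlen⟩
  · -- over `B2`: every gate is binary
    intro g hg
    change g ∈ gates at hg
    rw [hgates, List.mem_ofFn] at hg
    obtain ⟨j, rfl⟩ := hg
    rw [hG]
    change (2 : ℕ) ≤ 2
    exact le_rfl
  · -- computes `f`: on the row of `ξ` the true transcript is `j ↦ σ (gateV x j)`
    intro ξ
    set x : Fin (2 ^ n) := boolFunEquivFin n ξ with hx
    have hξ : (boolFunEquivFin n).symm x = ξ := by rw [hx, Equiv.symm_apply_apply]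
    set T := transcript ξ [] C.gates with hT
    -- value of a source wire, given the gate values below `j`
    have hsv : ∀ j, (∀ m < j, m < s → T.getD m false = σ (gateV x.1 m)) →
        ∀ w < n + j, j ≤ s → wireVal ξ T (tw w) = σ (srcV n x.1 w) := by
      intro j ih w hw hjs
      unfold srcV
      by_cases hlt : w < n
      · rw [htw_lt hlt, if_pos hlt]
        change ξ ⟨w, hlt⟩ = _
        rw [← hξ, hin x ⟨w, hlt⟩]
      · rw [htw_ge hlt, if_neg hlt]
        change T.getD (w - n) false = _
        exact ih (w - n) (by omega) (by omega)
    have key : ∀ j, j < s → T.getD j false = σ (gateV x.1 j) := by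
      intro j
      induction j using Nat.strong_induction_on with
      | _ j ih =>
        intro hjs
        have hjl : j < C.gates.length := by change j < gates.length; omega
        rw [hT, getD_transcript_eq_gateValue C ξ j hjl, ← hT]
        have hgj : C.gates[j] = ⟨2, fun u => σ (opV j (u 0) (u 1)), fun k => tw (src j k)⟩ :=
          hget j hjs hjl
        rw [hgj]
        change σ (opV j (wireVal ξ T (tw (src j ((0 : Fin 2) : ℕ))))
          (wireVal ξ T (tw (src j ((1 : Fin 2) : ℕ))))) = _
        have ih' : ∀ m < j, m < s → T.getD m false = σ (gateV x.1 m) := fun m hm hms => ih m hm hms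
        have h0 := hsrc j 0 hjs (by norm_num)
        have h1 := hsrc j 1 hjs (by norm_num)
        rw [show ((0 : Fin 2) : ℕ) = 0 from rfl, show ((1 : Fin 2) : ℕ) = 1 from rfl,
          hsv j ih' (src j 0) h0.1 hjs.le, hsv j ih' (src j 1) h1.1 hjs.le,
          ← harg x.1 x.2 j hjs 0 (by norm_num) (src j 0) h0.1 h0.2,
          ← harg x.1 x.2 j hjs 1 (by norm_num) (src j 1) h1.1 h1.2, hgate x.1 x.2 j hjs]
    -- the output
    rw [eval_eq_wireVal C ξ, ← hT]
    change wireVal ξ T (tw out) = f ξ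
    rw [hsv s (fun m _ hms => key m hms) out hout_lt le_rfl, ← houtc x.1 x.2 out hout_lt hσout, htgt x, hξ]

/-! ## The `←` half: from a circuit to a satisfying assignment -/

/-- The binary truth table of a gate of fan-in `≤ 2` reproduces the gate on any argument vector
(`btable g (u 0) (u 1) = g.op u`, the missing arguments being irrelevant). [folklore] -/
private theorem btable_eq_op {n : ℕ} (g : Gate (Fin n)) (hg : g.arity ≤ 2) (u : Fin g.arity → Bool) (b₀ b₁ : Bool)
    (h₀ : ∀ h : 0 < g.arity, b₀ = u ⟨0, h⟩) (h₁ : ∀ h : 1 < g.arity, b₁ = u ⟨1, h⟩) :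
    btable g b₀ b₁ = g.op u := by
  unfold btable
  congr 1
  funext a
  by_cases ha : a.val = 0
  · rw [if_pos ha, h₀ (by omega)]
    congr 1; exact Fin.ext ha.symm
  · rw [if_neg ha]
    have ha1 : a.val = 1 := by have := a.isLt; omega
    rw [h₁ (by omega)]
    congr 1; exact Fin.ext ha1.symm

/-- **Completeness of the encoding** (`0 < n`): if a circuit over `B2` with at most `s` gates computes `f`, then
`Circuit_{s,n}(f, q)` is satisfiable — pad the circuit with dummy gates to exactly `s` gates, describe gate `j`
by the binary truth table of the `j`-th gate with argument `k` wired to the gate's `k`-th wire (to the input `0`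
when `k` is not an argument, which needs `0 < n`), the output by the output wire, and give the value variables
of row `x` the true transcript of the padded circuit on the `x`-th input.
[cite: Razborov1996ICALP, §5 p. 62] [cite: KrajicekProofComplexity2019, §19.5 p. 425] -/
theorem satisfiable_of_circuit {s n : ℕ} (hn : 0 < n) (f : (Fin n → Bool) → Bool) (C : Circuit (Fin n))
    (hB : C.IsOver B2) (hf : C.Computes f) (hs : C.size ≤ s) : (circuitCNF s n f).Satisfiable := by
  -- pad to exactly `s` gates
  set D : Circuit (Fin n) := C.padTo s with hD
  have hDs : D.gates.length = s := Circuit.size_padTo C hs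
  have hDB : D.IsOver B2 := Circuit.isOver_B2_padTo C s hB
  have hDf : ∀ ξ, D.eval ξ = f ξ := fun ξ => by rw [hD, Circuit.eval_padTo]; exact hf ξ
  have har : ∀ (j : ℕ) (hj : j < D.gates.length), (D.gates[j]).arity ≤ 2 := fun j hj =>
    hDB _ (List.getElem_mem hj)
  -- wire numbers: input `i` ↦ `i`, gate `m` ↦ `n + m`
  obtain ⟨wn, hwn_inl, hwn_inr⟩ : ∃ wn : Fin n ⊕ ℕ → ℕ,
      (∀ i, wn (Sum.inl i) = i.1) ∧ ∀ m, wn (Sum.inr m) = n + m :=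
    ⟨Sum.elim (fun i => i.1) (fun m => n + m), fun _ => rfl, fun _ => rfl⟩
  -- the chosen source of argument `k` of gate `j` (the input `0` if `k` is not an argument)
  obtain ⟨src, hsrc⟩ : ∃ src : ℕ → ℕ → ℕ, ∀ j k, src j k =
      if hj : j < D.gates.length then
        (if hk : k < (D.gates[j]).arity then wn ((D.gates[j]).args ⟨k, hk⟩) else 0) else 0 :=
    ⟨_, fun _ _ => rfl⟩
  have hsrc_lt : ∀ j < s, ∀ k, src j k < n + j := by
    intro j hj k
    rw [hsrc, dif_pos (hDs ▸ hj)]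
    by_cases hk : k < (D.gates[j]'(hDs ▸ hj)).arity
    · rw [dif_pos hk]
      cases hw : (D.gates[j]'(hDs ▸ hj)).args ⟨k, hk⟩ with
      | inl i => rw [hwn_inl]; have := i.isLt; omega
      | inr m => rw [hwn_inr]; have := D.wf j (hDs ▸ hj) ⟨k, hk⟩ m hw; omega
    · rw [dif_neg hk]; omega
  -- the output source
  set out : ℕ := wn D.output with hout
  have hout_lt : out < n + s := by
    rw [hout]
    cases hw : D.output with
    | inl i => rw [hwn_inl]; have := i.isLt; omega
    | inr m => rw [hwn_inr]; have := D.wf_output m hw; omega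
  -- rows: the input vector of row `x < 2 ^ n`
  obtain ⟨row, hrow⟩ : ∃ row : ℕ → Fin n → Bool,
      ∀ (x : ℕ) (hx : x < 2 ^ n), row x = (boolFunEquivFin n).symm ⟨x, hx⟩ :=
    ⟨fun x => if hx : x < 2 ^ n then (boolFunEquivFin n).symm ⟨x, hx⟩ else fun _ => false,
      fun x hx => by simp only [dif_pos hx]⟩
  -- the true transcripts and the source values
  obtain ⟨T, hT⟩ : ∃ T : ℕ → List Bool, ∀ x, T x = transcript (row x) [] D.gates := ⟨_, fun _ => rfl⟩
  obtain ⟨sval, hsval⟩ : ∃ sval : ℕ → ℕ → Bool,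
      ∀ x w, sval x w = if h : w < n then row x ⟨w, h⟩ else (T x).getD (w - n) false := ⟨_, fun _ _ => rfl⟩
  have hsval_wn : ∀ x (w' : Fin n ⊕ ℕ), sval x (wn w') = wireVal (row x) (T x) w' := by
    intro x w'
    cases w' with
    | inl i => rw [hwn_inl, hsval, dif_pos i.isLt]; rfl
    | inr m =>
      rw [hwn_inr, hsval, dif_neg (by omega)]
      change (T x).getD (n + m - n) false = (T x).getD m false
      rw [Nat.add_sub_cancel_left]
  -- op-tables: the binary truth table of gate `j`
  obtain ⟨op, hop⟩ : ∃ op : ℕ → Bool → Bool → Bool, ∀ j a b, op j a b =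
      if hj : j < D.gates.length then btable (D.gates[j]) a b else false := ⟨_, fun _ _ _ => rfl⟩
  -- the gate equations of the padded circuit in terms of `op`, `sval`, `src`
  have hK2 : ∀ x, ∀ j < s, (T x).getD j false = op j (sval x (src j 0)) (sval x (src j 1)) := by
    intro x j hj
    have hjl : j < D.gates.length := hDs ▸ hj
    rw [hT, getD_transcript_eq_gateValue D (row x) j hjl, ← hT, hop, dif_pos hjl]
    unfold gateValue
    refine (btable_eq_op _ (har j hjl) _ _ _ (fun h0 => ?_) (fun h1 => ?_)).symm
    · rw [hsrc, dif_pos hjl, dif_pos h0, hsval_wn]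
    · rw [hsrc, dif_pos hjl, dif_pos h1, hsval_wn]
  have hK3 : ∀ x, sval x out = D.eval (row x) := by
    intro x
    rw [hout, hsval_wn, eval_eq_wireVal D (row x), ← hT]
  -- the assignment, by the tag of the variable
  obtain ⟨A, hA⟩ : ∃ A : ℕ → ℕ → ℕ → ℕ → Bool, ∀ t a b c, A t a b c =
      if t = 0 then op a (b == 1) (c == 1)
      else if t = 1 then decide (c = src a b)
      else if t = 2 then decide (a = out)
      else if t = 3 then (if hb : b < n then row a ⟨b, hb⟩ else false)
      else if t = 4 then (T a).getD b false
      else if t = 5 then sval a (src b c)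
      else if t = 6 then sval a out
      else false := ⟨_, fun _ _ _ _ => rfl⟩
  let σ : ℕ → Bool := fun m =>
    A (Nat.unpair m).1 (Nat.unpair (Nat.unpair m).2).1 (Nat.unpair (Nat.unpair (Nat.unpair m).2).2).1
      (Nat.unpair (Nat.unpair (Nat.unpair m).2).2).2
  have hσv : ∀ t a b c, σ (v t a b c) = A t a b c := by
    intro t a b c
    simp only [σ, v, Nat.unpair_pair]
  have hσop : ∀ j a b, σ (opV j a b) = op j a b := by
    intro j a b
    unfold opV
    rw [hσv, hA, if_pos rfl]
    cases a <;> cases b <;> rfl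
  have hσsel : ∀ j k w, σ (selV j k w) = decide (w = src j k) := by
    intro j k w
    unfold selV
    rw [hσv, hA]
    simp
  have hσout : ∀ w, σ (outV w) = decide (w = out) := by
    intro w
    unfold outV
    rw [hσv, hA]
    simp
  have hσin : ∀ x (i : Fin n), σ (inV x i.1) = row x i := by
    intro x i
    unfold inV
    rw [hσv, hA]
    simp [i.isLt]
  have hσgate : ∀ x j, σ (gateV x j) = (T x).getD j false := by
    intro x j
    unfold gateV
    rw [hσv, hA]
    simp
  have hσarg : ∀ x j k, σ (argV x j k) = sval x (src j k) := by
    intro x j k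
    unfold argV
    rw [hσv, hA]
    simp
  have hσres : ∀ x, σ (resV x) = sval x out := by
    intro x
    unfold resV
    rw [hσv, hA]
    simp
  have hσsrc : ∀ x w, σ (srcV n x w) = sval x w := by
    intro x w
    unfold srcV
    by_cases hw : w < n
    · rw [if_pos hw, hσin x ⟨w, hw⟩, hsval, dif_pos hw]
    · rw [if_neg hw, hσgate, hsval, dif_neg hw]
  -- check the clauses
  refine ⟨σ, (CNF.eval_eq_true_iff _ σ).2 fun c hc => ?_⟩
  rcases mem_circuitCNF.1 hc with hc | hc | hc | hc | hc | hc
  · -- selector clauses: the chosen source is selected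
    rcases mem_selClauses.1 hc with ⟨j, hj, k, -, rfl⟩ | rfl
    · refine ceval_of_mem (selV j k (src j k)) true ?_ (by rw [hσsel]; simp)
      exact List.mem_map.2 ⟨src j k, List.mem_range.2 (hsrc_lt j hj k), rfl⟩
    · refine ceval_of_mem (outV out) true ?_ (by rw [hσout]; simp)
      exact List.mem_map.2 ⟨out, List.mem_range.2 hout_lt, rfl⟩
  · -- input clauses
    obtain ⟨x, i, rfl⟩ := mem_inputClauses.1 hc
    refine ceval_of_mem _ _ (List.mem_singleton.2 rfl) ?_
    rw [hσin, hrow x.1 x.2]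
  · -- wiring clauses
    obtain ⟨x, -, j, -, k, -, w, -, h⟩ := mem_argClauses.1 hc
    by_cases hw : w = src j k
    · have h1 : σ (argV x j k) = σ (srcV n x w) := by rw [hσarg, hσsrc, hw]
      rcases h with rfl | rfl
      · cases hv : σ (srcV n x w)
        · exact ceval_of_mem (argV x j k) false (by simp) (by rw [h1, hv])
        · exact ceval_of_mem (srcV n x w) true (by simp) hv
      · cases hv : σ (srcV n x w)
        · exact ceval_of_mem (srcV n x w) false (by simp) hv
        · exact ceval_of_mem (argV x j k) true (by simp) (by rw [h1, hv])
    · have h1 : σ (selV j k w) = false := by rw [hσsel]; simp [hw]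
      rcases h with rfl | rfl
      · exact ceval_of_mem (selV j k w) false (by simp) h1
      · exact ceval_of_mem (selV j k w) false (by simp) h1
  · -- gate clauses
    obtain ⟨x, -, j, hj, a, b, h⟩ := mem_gateClauses.1 hc
    by_cases ha : σ (argV x j 0) = a
    · by_cases hb : σ (argV x j 1) = b
      · have hgo : σ (gateV x j) = σ (opV j a b) := by
          rw [hσgate, hσop, hK2 x j hj, ← ha, ← hb, hσarg, hσarg]
        rcases h with rfl | rfl
        · cases hv : σ (opV j a b)
          · exact ceval_of_mem (gateV x j) false (by simp) (by rw [hgo, hv])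
          · exact ceval_of_mem (opV j a b) true (by simp) hv
        · cases hv : σ (opV j a b)
          · exact ceval_of_mem (opV j a b) false (by simp) hv
          · exact ceval_of_mem (gateV x j) true (by simp) (by rw [hgo, hv])
      · rcases h with rfl | rfl
        · exact ceval_of_mem (argV x j 1) (!b) (by simp) (eq_not_of_ne' hb)
        · exact ceval_of_mem (argV x j 1) (!b) (by simp) (eq_not_of_ne' hb)
    · rcases h with rfl | rfl
      · exact ceval_of_mem (argV x j 0) (!a) (by simp) (eq_not_of_ne' ha)
      · exact ceval_of_mem (argV x j 0) (!a) (by simp) (eq_not_of_ne' ha)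
  · -- output clauses
    obtain ⟨x, -, w, -, h⟩ := mem_outClauses.1 hc
    by_cases hw : w = out
    · have h1 : σ (resV x) = σ (srcV n x w) := by rw [hσres, hσsrc, hw]
      rcases h with rfl | rfl
      · cases hv : σ (srcV n x w)
        · exact ceval_of_mem (resV x) false (by simp) (by rw [h1, hv])
        · exact ceval_of_mem (srcV n x w) true (by simp) hv
      · cases hv : σ (srcV n x w)
        · exact ceval_of_mem (srcV n x w) false (by simp) hv
        · exact ceval_of_mem (resV x) true (by simp) (by rw [h1, hv])
    · have h1 : σ (outV w) = false := by rw [hσout]; simp [hw]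
      rcases h with rfl | rfl
      · exact ceval_of_mem (outV w) false (by simp) h1
      · exact ceval_of_mem (outV w) false (by simp) h1
  · -- target clauses: the transcript's output is `f`
    obtain ⟨x, rfl⟩ := mem_targetClauses.1 hc
    refine ceval_of_mem _ _ (List.mem_singleton.2 rfl) ?_
    rw [hσres, hK3, hDf, hrow x.1 x.2]

end TT

/-- **Razborov 1996, §5 — correctness of `Circuit_{s,n}(f, q)`, DISCHARGE of the named fact
`circuitCNF_satisfiable_iff`:** for `0 < n`, the CNF `TT.circuitCNF s n f` is satisfiable iff some circuit over
`B2` with at most `s` gates computes `f` (`TT.exists_circuit_of_satisfiable`, `TT.satisfiable_of_circuit`).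
[cite: Razborov1996ICALP, §5 p. 62] [cite: KrajicekProofComplexity2019, §19.5 p. 425] -/
theorem circuitCNF_satisfiable_iff_holds : circuitCNF_satisfiable_iff := by
  intro s n f hn
  exact ⟨fun h => TT.exists_circuit_of_satisfiable f h,
    fun ⟨C, hB, hf, hs⟩ => TT.satisfiable_of_circuit hn f C hB hf hs⟩

end Literature.Computability.MetaComplexity
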